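import Literature.Geometry.Lorentzian.ChartCalculus
import Mathlib.Analysis.Calculus.ContDiff.Operations
import Mathlib.LinearAlgebra.Dual.Lemmas
import HarnessLib

/-!
# The inverse of the components of a chart metric: invertibility and smoothness

Topic `Geometry/Riemannian` (chart calculus, `OpensChart` setting). For a metric `g_U` on
`U : Opens V` with components `G_U : V → (V →L V →L ℝ)` (`g_U.val y = G_U y`), each `G_U y` is an
invertible continuous linear map `V →L (V →L ℝ)` (nondegeneracy and `dim V* = dim V`), the
components are `C^∞` (`OpensChart.contMDiffAt_bilinSection_iff`), and hence
`y ↦ (G_U y)⁻¹` is `C^∞` (`ContinuousLinearMap.IsInvertible.contDiffAt_map_inverse`). This is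
the sharp `♯` of the metric read in coordinates, `♯_y β = (G_U y)⁻¹ β`
(`val_inverse_metricComponents_apply`), used to write down smooth `g_U`-normal fields of level
hypersurfaces of the model open set (the round sphere of the interior surgery of Weinstein's disk).

* `contDiffAt_metricComponents` — `G_U` is `C^∞` at the points of `U`;
* `isInvertible_metricComponents` — `G_U y` is invertible;
* `apply_inverse_metricComponents`, `val_inverse_metricComponents_apply` —
  `G_U y ((G_U y)⁻¹ β) = β`, i.e. `g_U(♯β, w) = β w`;
* `contDiffAt_inverse_metricComponents` — `y ↦ (G_U y)⁻¹` is `C^∞`.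

## References

* B. O'Neill, *Semi-Riemannian Geometry* (1983), Ch. 3, p. 60 (musical isomorphisms).
  [cite: ONeill1983, Ch. 3, p. 60]
* A. Weinstein, Ann. of Math. (2) 87 (1968), 29–41. [cite: Weinstein1968]

Tags: [ChartCalculus] [MusicalIsomorphism] [Weinstein1968]
-/

noncomputable section

open Bundle Set Function Filter TopologicalSpace Module
open scoped Manifold ContDiff Topology

namespace Literature.Geometry.Riemannian

open Literature.Geometry.Lorentzian
open Literature.Geometry.Lorentzian.OpensChart

variable {V : Type*} [NormedAddCommGroup V] [NormedSpace ℝ V] [FiniteDimensional ℝ V]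
  {U : Opens V} {n : ℕ∞ω}
  (gU : PseudoRiemannianMetric 𝓘(ℝ, V) n V (TangentSpace 𝓘(ℝ, V) : U → Type _))
  (GU : V → V →L[ℝ] V →L[ℝ] ℝ)

omit [FiniteDimensional ℝ V] in
/-- **The components of a chart metric are as smooth as the metric.** [folklore] -/
theorem contDiffAt_metricComponents (hG : ∀ y : U, gU.val y = GU y) (y : U) :
    ContDiffAt ℝ n GU y :=
  (contMDiffAt_bilinSection_iff y gU.val GU hG).1 (gU.contMDiff y)

/-- **The components are invertible maps `V →L (V →L ℝ)`** (nondegeneracy of `g_U` and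
`dim (V →L ℝ) = dim V`). [cite: ONeill1983, Ch. 3, p. 60] -/
theorem isInvertible_metricComponents (hG : ∀ y : U, gU.val y = GU y) (y : U) :
    (GU y).IsInvertible := by
  -- injective by nondegeneracy
  have hinj : Injective (GU y) := by
    intro a b hab
    have h : ∀ w : V, gU.val y (a - b) w = 0 := fun w ↦ by
      have e1 : gU.val y (a - b) w = GU y (a - b) w :=
        DFunLike.congr_fun (DFunLike.congr_fun (hG y) (a - b)) w
      rw [e1, map_sub, hab, sub_self]
      rfl
    exact sub_eq_zero.1 (gU.nondegenerate y (a - b) h)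
  -- same finite dimension
  have hdim : finrank ℝ V = finrank ℝ (V →L[ℝ] ℝ) := by
    have e : (V →L[ℝ] ℝ) ≃ₗ[ℝ] Module.Dual ℝ V := LinearMap.toContinuousLinearMap.symm
    rw [e.finrank_eq, Subspace.dual_finrank_eq]
  set e : V ≃L[ℝ] (V →L[ℝ] ℝ) :=
    (LinearMap.linearEquivOfInjective (GU y : V →ₗ[ℝ] V →L[ℝ] ℝ) hinj hdim).toContinuousLinearEquiv
    with he
  refine ⟨e, ?_⟩
  ext v w
  rfl

/-- **`G_U y ((G_U y)⁻¹ β) = β`.** [cite: ONeill1983, Ch. 3, p. 60] -/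
theorem apply_inverse_metricComponents (hG : ∀ y : U, gU.val y = GU y) (y : U) (β : V →L[ℝ] ℝ) :
    GU y ((GU y).inverse β) = β := by
  obtain ⟨e, he⟩ := isInvertible_metricComponents gU GU hG y
  rw [← he, ContinuousLinearMap.inverse_equiv]
  simp

/-- **`g_U(♯β, w) = β w`** with `♯β = (G_U y)⁻¹ β`. [cite: ONeill1983, Ch. 3, p. 60] -/
theorem val_inverse_metricComponents_apply (hG : ∀ y : U, gU.val y = GU y) (y : U)
    (β : V →L[ℝ] ℝ) (w : V) :
    gU.val y ((GU y).inverse β) w = β w := by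
  rw [hG y]
  exact DFunLike.congr_fun (apply_inverse_metricComponents gU GU hG y β) w

/-- **`y ↦ (G_U y)⁻¹` is `C^n`** (inversion is smooth at invertible maps). [folklore] -/
theorem contDiffAt_inverse_metricComponents (hG : ∀ y : U, gU.val y = GU y) (y : U) :
    ContDiffAt ℝ n (fun v : V ↦ (GU v).inverse) y := by
  haveI : CompleteSpace V := FiniteDimensional.complete ℝ V
  exact ((isInvertible_metricComponents gU GU hG y).contDiffAt_map_inverse).comp (y : V)
    (contDiffAt_metricComponents gU GU hG y)

end Literature.Geometry.Riemannian

end
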